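import Mathlib
import Summits.NavierStokesRegularity.NavierStokesRegularity.Theses.HiddenConvexityPressureFloor
import Summits.NavierStokesRegularity.NavierStokesRegularity.Theorems.HiddenConvexityPressureFloorPressureFloorOfSemiconcave
import Summits.NavierStokesRegularity.NavierStokesRegularity.Theorems.HiddenConvexityPressureFloorSereginSverakFloorExtension
import HarnessLib

/-!
# `HiddenConvexityPressureFloor.UniformModulusNoBlowup` — uniform semiconcavity of the normalised
  pressure excludes blow-up (item stmt-NavierStokesRegularity-2965; glue)

**Statement.** If every classical solution on `ℝ³ × [0, T)`, Leray–Hopf from a rapidly decaying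
datum, has a UNIFORM semiconcavity modulus of its normalised pressure (`∃ K, ∀ t < T,
x ↦ p̃[u(t)](x) - K‖x‖²/2` concave), then every such solution extends classically past `T`.

PROOF. Pure composition of the two accepted items of the route: `PressureFloorOfSemiconcave`
(stmt-2964, `hiddenConvexityPressureFloor_pressureFloorOfSemiconcave_proof`: a semiconcavity modulus
on `[0, T)` gives a pressure floor on `[0, T)`) and `SereginSverakFloorExtension` (stmt-2963,
`hiddenConvexityPressureFloor_sereginSverakFloorExtension_proof`: a pressure floor on `[0, T)` gives
continuation past `T`).

HONEST FRAMING: glue between route statements; the antecedent (a uniform semiconcavity modulus for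
every Clay-class solution) is NOT claimed — nothing here bears on the regularity problem itself.
-/

noncomputable section

set_option linter.dupNamespace false

namespace Summit.NavierStokesRegularity.NavierStokesRegularity.Theorems

open Summit.NavierStokesRegularity.NavierStokesRegularity.Theses.HiddenConvexityPressureFloor in
/-- **Item stmt-NavierStokesRegularity-2965** (`HiddenConvexityPressureFloor.UniformModulusNoBlowup`):
uniform semiconcavity ⇒ pressure floor (stmt-2964) ⇒ continuation (stmt-2963). [this file] -/
theorem hiddenConvexityPressureFloor_uniformModulusNoBlowup_proof :
    Summit.NavierStokesRegularity.NavierStokesRegularity.Theses.HiddenConvexityPressureFloor.UniformModulusNoBlowup := by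
  unfold Summit.NavierStokesRegularity.NavierStokesRegularity.Theses.HiddenConvexityPressureFloor.UniformModulusNoBlowup
  intro hX ν T hν hT u p hsol hLH h₀
  have hfloor : PressureFloorOfSemiconcave :=
    hiddenConvexityPressureFloor_pressureFloorOfSemiconcave_proof
  have hext : SereginSverakFloorExtension :=
    hiddenConvexityPressureFloor_sereginSverakFloorExtension_proof
  obtain ⟨K, hK⟩ := hX ν T hν hT u p hsol hLH h₀
  exact hext ν T hν hT u p hsol hLH h₀ (hfloor ν T hν hT u p hsol hLH h₀ K hK)

end Summit.NavierStokesRegularity.NavierStokesRegularity.Theorems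

end
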